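import Mathlib
import Summits.Ventures.HodgeRepro0.P6AokiQuotientBridge

/-!
# Aoki's quotient `B_q/(S_q + D_q)` at explicit levels — kernel certificates (part 3: the structure theorem from a certificate)

The objects are Aoki's (Math. Ann. 266 (1983), pp. 25–26, 36, as the cell's records transcribe them):
`R_q` = the free abelian group on `ℤ/q ∖ {0}`, here `Fin (q-1) → ℤ` with index `a - 1 ↔ (a)`;
`θ_t(α) = Σ_a c_a (⟨t·a/q⟩ − 1/2)` for units `t`, here scaled by `2q`: `thetaN q t a = 2·((t·a) mod q) − q`;
`B_q = Ker θ`; the standard elements `σ_{p,i}`; `D_q` spanned by the pairs `(a) + (−a)` (and `(q/2)`);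
`S_q + D_q` = the `ℤ`-span of all standard elements and pairs (the `ℤ[G_q]`-span, since `G_q` permutes them).
Part 3 proves, from kernel-decidable facts about certificate lists, the structure `B_q = (S_q + D_q) + ⟨β⟩`, `B_q/(S_q + D_q) ≅ (ℤ/2)^k`, and the triviality of the `G_q`-action on the quotient.
-/

namespace HodgeRepro0.P6AokiQuotient

/-! ### The structure theorem from a certificate -/

/-- The structure theorem from the certificate hypotheses (Fin-level form). -/
theorem main_of_certificate (q : ℕ) {r m k : ℕ}
    (piv : Fin r → Fin (q - 1)) (P : Fin m → Fin (q - 1)) (ℓ : Fin r → Fin (q - 1) → ℤ)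
    (Y : Fin m → Fin (unitsList q).length → ℤ) (d : ℤ) (hd : d ≠ 0)
    (β : Fin k → Fin (q - 1) → ℤ) (F : Fin k → (Fin (q - 1) → ℤ) →ₗ[ℤ] ZMod 2)
    (hSDB : SD q ≤ B q) (hβB : ∀ j, β j ∈ B q)
    (hℓ : ∀ i j, ℓ i (piv j) = if i = j then 1 else 0)
    (hY : ∀ i j, ∑ s, Y i s * theta q ((unitsList q).get s) (P j) = if i = j then d else 0)
    (hcover : ∀ a, (∃ i, piv i = a) ∨ (∃ j, P j = a))
    (hPinj : Function.Injective P)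
    (hℓmem : ∀ i, ℓ i ∈ SD q ⊔ Submodule.span ℤ (Set.range β))
    (hF_SD : ∀ j, SD q ≤ LinearMap.ker (F j))
    (hFβ : ∀ j j', F j (β j') = if j = j' then 1 else 0)
    (h2β : ∀ j, (2 : ℤ) • β j ∈ SD q)
    (hσSD : ∀ t ∈ unitsList q, Submodule.map (sigmaL q t) (SD q) ≤ SD q)
    (hσβ : ∀ t ∈ unitsList q, ∀ j, sigmaL q t (β j) - β j ∈ SD q) :
    SD q ≤ B q ∧ B q = SD q ⊔ Submodule.span ℤ (Set.range β) ∧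
    (∀ c : Fin k → ℤ, (∑ j, c j • β j) ∈ SD q ↔ ∀ j, 2 ∣ c j) ∧
    (∀ v ∈ B q, ∀ t ∈ unitsList q, sigmaL q t v - v ∈ SD q) := by
  have hspanβ : Submodule.span ℤ (Set.range β) ≤ B q := by
    rw [Submodule.span_le]; rintro _ ⟨j, rfl⟩; exact hβB j
  have hsupB : SD q ⊔ Submodule.span ℤ (Set.range β) ≤ B q := sup_le hSDB hspanβ
  have hBeq : B q = SD q ⊔ Submodule.span ℤ (Set.range β) := by
    apply le_antisymm _ hsupB
    intro v hv
    rw [decompose q piv P ℓ Y d hd hℓ hY hcover hPinj (fun i => hsupB (hℓmem i)) v hv]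
    exact Submodule.sum_mem _ (fun i _ => Submodule.smul_mem _ _ (hℓmem i))
  refine ⟨hSDB, hBeq, ?_, ?_⟩
  · intro c
    constructor
    · intro hc j
      have h1 : F j (∑ j', c j' • β j') = (c j : ZMod 2) := by
        rw [map_sum]
        simp only [map_zsmul, hFβ, smul_ite, smul_zero, Finset.sum_ite_eq, Finset.mem_univ, if_true]
        exact Int.smul_one_eq_cast _
      have h2 : F j (∑ j', c j' • β j') = 0 := hF_SD j hc
      rw [h1] at h2
      exact (ZMod.intCast_zmod_eq_zero_iff_dvd _ 2).mp h2
    · intro hc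
      apply Submodule.sum_mem; intro j _
      obtain ⟨e, he⟩ := hc j
      rw [he, mul_comm, mul_smul]
      exact Submodule.smul_mem _ _ (h2β j)
  · intro v hv t ht
    rw [hBeq] at hv
    obtain ⟨s, hs, w, hw, rfl⟩ := Submodule.mem_sup.mp hv
    obtain ⟨c, rfl⟩ := (Submodule.mem_span_range_iff_exists_fun ℤ).mp hw
    have hσs : sigmaL q t s - s ∈ SD q := (SD q).sub_mem (hσSD t ht (Submodule.mem_map_of_mem hs)) hs
    have hσw : sigmaL q t (∑ j, c j • β j) - ∑ j, c j • β j ∈ SD q := by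
      rw [map_sum]
      have : ∑ j, sigmaL q t (c j • β j) - ∑ j, c j • β j = ∑ j, c j • (sigmaL q t (β j) - β j) := by
        rw [← Finset.sum_sub_distrib]; apply Finset.sum_congr rfl; intro j _; rw [map_zsmul, smul_sub]
      rw [this]
      exact Submodule.sum_mem _ (fun j _ => Submodule.smul_mem _ _ (hσβ t ht j))
    have : sigmaL q t (s + ∑ j, c j • β j) - (s + ∑ j, c j • β j)
        = (sigmaL q t s - s) + (sigmaL q t (∑ j, c j • β j) - ∑ j, c j • β j) := by
      rw [map_add]; abel
    rw [this]; exact (SD q).add_mem hσs hσw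


/-- The structure theorem at level `q` from kernel-decidable facts about the certificate lists
`gd` (the dense generator lists, asserted equal to `genDense q` once), `ellL` (the rows `ℓ_i`), `pivL` / `PL`
(pivot and complement indices), `YL` / `d` (the left inverse of the `P`-columns of `θ`), `betaL` (the
generators `β_j` of the quotient), `FL` (the parity functionals), `exprG` / `exprC` (each `ℓ_i` as a
combination of generators and `β`'s: indices and coefficients), `twoBG` / `twoBC` (`2β_j` in the generators),
`gens` (generators of the unit group, with `wordsL` writing every unit as a word in them) and `sigG` / `sigC`
(`σ_g β_j − β_j` in the generators, for every `g ∈ gens`). -/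
theorem level_of_decided (q : ℕ) (r m k : ℕ) (gd : List (List ℤ)) (hgd : gd = genDense q)
    (ellL : List (List ℤ)) (pivL PL : List ℕ) (YL : List (List ℤ)) (d : ℤ)
    (betaL FL : List (List ℤ)) (exprG : List (List ℕ)) (exprC : List (List ℤ))
    (twoBG : List (List ℕ)) (twoBC : List (List ℤ))
    (gens : List ℕ) (wordsL : List (List ℕ))
    (sigG : List (List (List ℕ))) (sigC : List (List (List ℤ)))
    (hd : d ≠ 0)
    (hbound : ∀ es ∈ genEntries q, ∀ a ∈ es, 1 ≤ a ∧ a ≤ q - 1)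
    (hθ : ∀ es ∈ genEntries q, ∀ t ∈ unitsList q, (es.map (thetaN q t)).sum = 0)
    (hpiv : ∀ i < r, pivL.getD i 0 < q - 1)
    (hP : ∀ j < m, PL.getD j 0 < q - 1)
    (hℓ : ∀ i < r, ∀ j < r, (ellL.getD i []).getD (pivL.getD j 0) 0 = if i = j then 1 else 0)
    (hY : ∀ i < m, ∀ j < m, ((List.range (unitsList q).length).map
        (fun s => (YL.getD i []).getD s 0 * thetaN q ((unitsList q).getD s 0) (PL.getD j 0 + 1))).sum
        = if i = j then d else 0)
    (hcover : ∀ a < q - 1, (∃ i < r, pivL.getD i 0 = a) ∨ (∃ j < m, PL.getD j 0 = a))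
    (hPinj : ∀ j < m, ∀ j' < m, PL.getD j 0 = PL.getD j' 0 → j = j')
    (hβlen : betaL.length = k ∧ ∀ l ∈ betaL, l.length = q - 1)
    (hℓexpr : ∀ i < r, ellL.getD i [] =
        lincombList (q - 1) (List.zip (exprG.getD i []) (exprC.getD i [])) (gd ++ betaL))
    (hβB : ∀ j < k, ∀ t ∈ unitsList q,
        ((List.range (q - 1)).map (fun a => thetaN q t (a + 1) * (betaL.getD j []).getD a 0)).sum = 0)
    (hpar : ∀ j < k, ∀ es ∈ genEntries q, (es.map (fun a => (FL.getD j []).getD (a - 1) 0)).sum % 2 = 0)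
    (hparβ : ∀ j < k, ∀ j' < k, ((List.range (q - 1)).map
        (fun a => (FL.getD j []).getD a 0 * (betaL.getD j' []).getD a 0)).sum % 2 = if j = j' then 1 else 0)
    (h2β : ∀ j < k, smulL 2 (betaL.getD j []) =
        lincombList (q - 1) (List.zip (twoBG.getD j []) (twoBC.getD j [])) gd)
    (hgu : ∀ g ∈ gens, Nat.gcd g q = 1)
    (hwords : ∀ s < (unitsList q).length,
        (unitsList q).getD s 0 = (wordsL.getD s []).foldl (fun x i => (x * gens.getD i 1) % q) 1)
    (F1 : ∀ t ∈ gens, ∀ p ∈ oddPrimeDivisors q, ∀ i ∈ admissible q p,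
        ((t * i) % q < q ∧ admissibleP q p ((t * i) % q) = true) ∧
        ((stdEntries q p i).map (fun a => (t * a) % q)).Perm (stdEntries q p ((t * i) % q)))
    (F2 : ∀ t ∈ gens, ∀ j < (q - 1) / 2, ∃ j' < (q - 1) / 2,
        (([j + 1, q - (j + 1)]).map (fun a => (t * a) % q)).Perm [j' + 1, q - (j' + 1)])
    (F3 : q % 2 = 0 → ∀ t ∈ gens, (t * (q / 2)) % q = q / 2)
    (F4 : q % 4 = 0 → ∀ t ∈ gens, ∀ i ∈ admissible q 2,
        ((t * i) % q < q ∧ admissibleP q 2 ((t * i) % q) = true) ∧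
        ((std2Entries q i).map (fun a => (t * a) % q)).Perm (std2Entries q ((t * i) % q)))
    (hσβ : ∀ s < gens.length, ∀ j < k,
        vsubL (sigmaList q (gens.getD s 0) (betaL.getD j [])) (betaL.getD j [])
        = lincombList (q - 1) (List.zip ((sigG.getD s []).getD j []) ((sigC.getD s []).getD j [])) gd) :
    SD q ≤ B q ∧
    B q = SD q ⊔ Submodule.span ℤ (Set.range (fun j : Fin k => toV (q - 1) (betaL.getD j []))) ∧
    (∀ c : Fin k → ℤ, (∑ j, c j • toV (q - 1) (betaL.getD j [])) ∈ SD q ↔ ∀ j, 2 ∣ c j) ∧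
    (∀ v ∈ B q, ∀ t ∈ unitsList q, sigmaL q t v - v ∈ SD q) := by
  subst hgd
  have hβl : ∀ j : Fin k, (betaL.getD j []).length = q - 1 := by
    intro j
    have hj : j.val < betaL.length := by rw [hβlen.1]; exact j.isLt
    rw [List.getD_eq_getElem _ _ hj]; exact hβlen.2 _ (List.getElem_mem hj)
  have hlenall : ∀ l ∈ genDense q ++ betaL, l.length = q - 1 := by
    intro l hl
    rcases List.mem_append.mp hl with h | h
    · exact genDense_length q l h
    · exact hβlen.2 l h
  -- the generator facts: every `g ∈ gens` is a unit, stabilises `SD q` and moves each `β_j` inside `SD q`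
  have hg : ∀ g ∈ gens, Nat.Coprime g q ∧ Submodule.map (sigmaL q g) (SD q) ≤ SD q ∧
      ∀ j : Fin k, sigmaL q g (toV (q - 1) (betaL.getD j [])) - toV (q - 1) (betaL.getD j []) ∈ SD q := by
    intro g hgm
    refine ⟨hgu g hgm, ?_, ?_⟩
    · refine sigma_SD_le q g hbound (hperm_of_facts q g ?_ (F2 g hgm) (F3 · g hgm) ?_)
      · intro p hp i hi
        obtain ⟨⟨h1, h2⟩, h3⟩ := F1 g hgm p hp i hi
        exact ⟨mem_admissible.mpr ⟨h1, h2⟩, h3⟩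
      · intro h4 i hi
        obtain ⟨⟨h1, h2⟩, h3⟩ := F4 h4 g hgm i hi
        exact ⟨mem_admissible.mpr ⟨h1, h2⟩, h3⟩
    · intro j
      obtain ⟨s, hs, rfl⟩ := List.mem_iff_getElem.mp hgm
      have hsg : gens[s] = gens.getD s 0 := (List.getD_eq_getElem _ _ hs).symm
      rw [sigmaL_apply, ← toV_sigmaList, ← toV_vsubL (length_sigmaList _ _ _) (hβl j), hsg]
      exact toV_mem_SD_of_lincomb q _ _ (hσβ s hs j j.isLt)
  -- every unit is a word in the generators
  have hall : ∀ t ∈ unitsList q, Submodule.map (sigmaL q t) (SD q) ≤ SD q ∧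
      ∀ j : Fin k, sigmaL q t (toV (q - 1) (betaL.getD j [])) - toV (q - 1) (betaL.getD j []) ∈ SD q := by
    intro t ht
    obtain ⟨s, hs, rfl⟩ := List.mem_iff_getElem.mp ht
    rw [← List.getD_eq_getElem _ _ hs, hwords s hs]
    exact act_word q (SD q) _ gens hg (wordsL.getD s [])
  refine main_of_certificate q (fun i => ⟨pivL.getD i 0, hpiv i i.isLt⟩) (fun j => ⟨PL.getD j 0, hP j j.isLt⟩)
    (fun i => toV (q - 1) (ellL.getD i [])) (fun i s => (YL.getD i []).getD s 0) d hd
    (fun j => toV (q - 1) (betaL.getD j [])) (fun j => parF (q - 1) (FL.getD j []))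
    (SD_le_B q hbound hθ) ?_ ?_ ?_ ?_ ?_ ?_ ?_ ?_ ?_ (fun t ht => (hall t ht).1) (fun t ht => (hall t ht).2)
  · -- β_j ∈ B
    intro j t ht
    exact (sum_fin_eq_list (q - 1) (fun a => thetaN q t (a + 1) * (betaL.getD j []).getD a 0)).trans
      (hβB j j.isLt t ht)
  · -- hℓ
    intro i j
    simp only [Fin.ext_iff]
    exact hℓ i i.isLt j j.isLt
  · -- hY
    intro i j
    have e : ∀ s : Fin (unitsList q).length,
        (YL.getD i []).getD s 0 * theta q ((unitsList q).get s) ⟨PL.getD j 0, hP j j.isLt⟩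
        = (fun s => (YL.getD i []).getD s 0 * thetaN q ((unitsList q).getD s 0) (PL.getD j 0 + 1)) s.val := by
      intro s
      simp only [theta, List.get_eq_getElem, List.getD_eq_getElem _ _ s.isLt]
    rw [Finset.sum_congr rfl (fun s _ => e s), sum_fin_eq_list (unitsList q).length
      (fun s => (YL.getD i []).getD s 0 * thetaN q ((unitsList q).getD s 0) (PL.getD j 0 + 1))]
    simp only [Fin.ext_iff]
    exact hY i i.isLt j j.isLt
  · -- hcover
    intro a
    rcases hcover a.val a.isLt with ⟨i, hi, hia⟩ | ⟨j, hj, hja⟩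
    · exact Or.inl ⟨⟨i, hi⟩, Fin.ext hia⟩
    · exact Or.inr ⟨⟨j, hj⟩, Fin.ext hja⟩
  · -- hPinj
    intro j j' h
    exact Fin.ext (hPinj j j.isLt j' j'.isLt (Fin.ext_iff.mp h))
  · -- hℓmem
    intro i
    rw [hℓexpr i i.isLt, toV_lincombList _ _ _ hlenall]
    apply lincombF_mem
    intro w hw
    rw [List.mem_map] at hw
    obtain ⟨l, hl, rfl⟩ := hw
    rcases List.mem_append.mp hl with h | h
    · apply Submodule.mem_sup_left
      simp only [genDense, List.mem_map] at h
      obtain ⟨es, hes, rfl⟩ := h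
      rw [toV_denseOf]; exact vecOf_mem_SD hes
    · apply Submodule.mem_sup_right
      obtain ⟨j, hj, rfl⟩ := List.mem_iff_getElem.mp h
      apply Submodule.subset_span
      refine ⟨⟨j, by rw [← hβlen.1]; exact hj⟩, ?_⟩
      simp only [List.getD_eq_getElem _ _ hj]
  · -- hF_SD
    intro j
    exact SD_le_ker_parF q _ hbound (hpar j j.isLt)
  · -- hFβ
    intro j j'
    rw [parF_toV, ← ZMod.intCast_mod _ 2]
    have := hparβ j j.isLt j' j'.isLt
    simp only [Nat.cast_ofNat] at this ⊢
    rw [this]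
    simp only [Fin.ext_iff]
    split_ifs <;> simp
  · -- h2β
    intro j
    rw [show (2 : ℤ) • toV (q - 1) (betaL.getD j []) = toV (q - 1) (smulL 2 (betaL.getD j [])) from
      (toV_smulL 2 (hβl j)).symm]
    exact toV_mem_SD_of_lincomb q _ _ (h2β j j.isLt)

end HodgeRepro0.P6AokiQuotient
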